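import Summits.CriticalPhenomena.PercolationContinuityZ3.Theorems.PercNearOneGluingNoHeavyLowerTailNineTypeCount
import Summits.CriticalPhenomena.PercolationContinuityZ3.Theorems.PercNearOneGluingNoHeavyLowerTailNineTypeKernels

/-!
# Label certificates: the nine-type count as a decision procedure for antipodal packings (all `n`)

Support file for crux `stmt-CriticalPhenomena-4575` (master-family programme, four-point quadratic rows), seat `prim-bnk-1`
gen 20; memo `run/shared/lean/prim/prim-l12/FROM-prim-bnk-1-gen20-LABEL-ATLAS.md`.

The abstract nine-type count `NineType.card_bad_le_card_good` (`prim-bnk-1` gen 19) is TABLE-DRIVEN: it bounds `#𝒯 ≤ #𝔊` for any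
family `𝒯` of subsets carrying labels `θ ∈ {1,…,9}` that obey the containment table `contPairs`, the covering rule, and whose
HL- and HH-forced unions lie in the up-set `𝔊`.  Nothing forces the points of `𝒯` to be the nine `Q44b` bad types.  This file turns
that observation into a decision procedure.  A *label certificate* is a finite set `P` of (heavy cell, light cell) pairs
(indices of `FourPointAtoms.pat4`) with a labelling `lab : Fin 15 × Fin 15 → ℕ`; `tableOK P lab` (Boolean `pairOK` clauses) is the decidable conjunction of
the lattice-theoretic conditions under which, for EVERY monotone map `ι` from the subsets of a finite type to the 15 cells,
the points `T` with `(ι T, ι Tᶜ) ∈ P`, labelled by `lab`, satisfy the hypotheses of the abstract count with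
`𝔊 = {T : ι T ∈ AC, ι Tᶜ = ⊥}`:

* CONT  `ple h h' ∧ ple l' l → (lab p, lab p') ∈ contPairs`;
* COV   `¬ (ple l h' ∧ ple l' h)`;
* HL    `hlOK (lab p) (lab p') →` every cell above `h` and `l'` is AC, every cell below `l` and `h'` is `⊥`;
* HH    `hhOK (lab p) (lab p') →` every cell above `h` and `h'` is AC, every cell below `l` and `l'` is `⊥`.

Results:
* `TwoCopyMono.cellCount_of_tableOK` — the count `#{T : (ι T, ι Tᶜ) ∈ P} ≤ #{T : ι T ∈ AC, ι Tᶜ = ⊥}` for every monotone `ι`;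
* `TwoCopyMono.goodKernel_kerP` — the kernel `[i ∈ AC ∧ j = ⊥] − [(i,j) ∈ P]` is a `GoodKernel`;
* `TwoCopyMono.pack_of_tableOK` — LAW LEVEL, all `n`: `Σ_{(h,l) ∈ P} cell h · cell l ≤ (cell(ab|cy) + cell(abcy)) · cell(a|b|c|y)`
  on every finite weighted graph, for every certificate passing `tableOK` (checked by `decide`).

`Q44b` itself is the certificate `P = {(h θ, l θ)}, lab = θ`; the atlas of maximal certificates (966 type sets in 135 classes
under the stabiliser of `ab|cy`, sizes 5–10; `Q44b` is one of them) is in the memo, and the first new members are landed in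
`…NineTypeLabelAtlas`.  Pure finite combinatorics on top of the gen-19 count; no named facts, no sorries, standard axioms.
-/

namespace Summit.CriticalPhenomena.PercolationContinuityZ3.Theorems

namespace TwoCopyMono

open Finset FourPointAtoms

/-! ## Certificates and the table check -/

/-- Join side of a forced good: every cell above `h` and `l` is an AC cell. [this work] -/
def upAC (h l : Fin 15) : Bool := decide (∀ x : Fin 15, ple h x = true → ple l x = true → isAC x)

/-- Meet side of a forced good: every cell below `l` and `h` is `⊥`. [this work] -/
def downBot (l h : Fin 15) : Bool := decide (∀ z : Fin 15, ple z l = true → ple z h = true → z = 0)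

/-- The pairwise table condition for two labelled oriented types `p = (h,l)`, `p' = (h',l')` with labels `a, a'`:
CONT, COV, HL (join and meet side), HH (join and meet side), all read off the refinement order `ple` of the 15 cells.
[this work] -/
def pairOK (p p' : Fin 15 × Fin 15) (a a' : ℕ) : Bool :=
  (!(ple p.1 p'.1 && ple p'.2 p.2) || decide ((a, a') ∈ NineType.contPairs)) &&
  !(ple p.2 p'.1 && ple p'.2 p.1) &&
  (!(NineType.hlOK a a') || (upAC p.1 p'.2 && downBot p.2 p'.1)) &&
  (!(NineType.hhOK a a') || (upAC p.1 p'.1 && downBot p.2 p'.2))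

/-- **The table check of a label certificate** `(P, lab)`: labels in `{1,…,9}` and `pairOK` for all ordered pairs of `P`
(a pair with itself included: two distinct points may carry the same oriented type). [this work] -/
def tableOK (P : Finset (Fin 15 × Fin 15)) (lab : Fin 15 × Fin 15 → ℕ) : Prop :=
  ∀ p ∈ P, (1 ≤ lab p ∧ lab p ≤ 9) ∧ ∀ p' ∈ P, pairOK p p' (lab p) (lab p') = true

/-- `tableOK` is decidable (so concrete certificates are checked by `decide`). [this work] -/
instance (P : Finset (Fin 15 × Fin 15)) (lab : Fin 15 × Fin 15 → ℕ) : Decidable (tableOK P lab) := by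
  unfold tableOK; infer_instance

/-- Unpacking `pairOK`: CONT. [this work] -/
theorem pairOK_cont {p p' : Fin 15 × Fin 15} {a a' : ℕ} (h : pairOK p p' a a' = true)
    (h1 : ple p.1 p'.1 = true) (h2 : ple p'.2 p.2 = true) : (a, a') ∈ NineType.contPairs := by
  unfold pairOK at h
  simp only [Bool.and_eq_true, Bool.or_eq_true, Bool.not_eq_true', decide_eq_true_eq, Bool.and_eq_false_iff] at h
  rcases h.1.1.1 with hc | hc
  · rcases hc with hc | hc
    · rw [h1] at hc; exact absurd hc (by decide)
    · rw [h2] at hc; exact absurd hc (by decide)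
  · exact hc

/-- Unpacking `pairOK`: COV. [this work] -/
theorem pairOK_cov {p p' : Fin 15 × Fin 15} {a a' : ℕ} (h : pairOK p p' a a' = true) :
    ¬ (ple p.2 p'.1 = true ∧ ple p'.2 p.1 = true) := by
  unfold pairOK at h
  simp only [Bool.and_eq_true, Bool.or_eq_true, Bool.not_eq_true', decide_eq_true_eq, Bool.and_eq_false_iff] at h
  rintro ⟨h1, h2⟩
  rcases h.1.1.2 with hc | hc
  · rw [h1] at hc; exact absurd hc (by decide)
  · rw [h2] at hc; exact absurd hc (by decide)

/-- Unpacking `pairOK`: HL. [this work] -/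
theorem pairOK_hl {p p' : Fin 15 × Fin 15} {a a' : ℕ} (h : pairOK p p' a a' = true)
    (hok : NineType.hlOK a a' = true) :
    (∀ x : Fin 15, ple p.1 x = true → ple p'.2 x = true → isAC x) ∧
    (∀ z : Fin 15, ple z p.2 = true → ple z p'.1 = true → z = 0) := by
  unfold pairOK at h
  simp only [Bool.and_eq_true, Bool.or_eq_true, Bool.not_eq_true'] at h
  rcases h.1.2 with hc | ⟨hu, hd⟩
  · rw [hok] at hc; exact absurd hc (by decide)
  · unfold upAC at hu; unfold downBot at hd
    exact ⟨of_decide_eq_true hu, of_decide_eq_true hd⟩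

/-- Unpacking `pairOK`: HH. [this work] -/
theorem pairOK_hh {p p' : Fin 15 × Fin 15} {a a' : ℕ} (h : pairOK p p' a a' = true)
    (hok : NineType.hhOK a a' = true) :
    (∀ x : Fin 15, ple p.1 x = true → ple p'.1 x = true → isAC x) ∧
    (∀ z : Fin 15, ple z p.2 = true → ple z p'.2 = true → z = 0) := by
  unfold pairOK at h
  simp only [Bool.and_eq_true, Bool.or_eq_true, Bool.not_eq_true'] at h
  rcases h.2 with hc | ⟨hu, hd⟩
  · rw [hok] at hc; exact absurd hc (by decide)
  · unfold upAC at hu; unfold downBot at hd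
    exact ⟨of_decide_eq_true hu, of_decide_eq_true hd⟩

/-- **The kernel of a certificate**: `[i ∈ AC ∧ j = ⊥] − [(i, j) ∈ P]`. [this work] -/
def kerP (P : Finset (Fin 15 × Fin 15)) (i j : Fin 15) : ℤ :=
  (if isAC i ∧ j = 0 then 1 else 0) - (if (i, j) ∈ P then 1 else 0)

/-! ## The count for monotone cell maps -/

/-- **The cell count of a certificate.**  If `tableOK P lab`, then for every monotone map `ι` from the subsets of a finite
type to the 15 cells, `#{T : (ι T, ι Tᶜ) ∈ P} ≤ #{T : ι T ∈ AC ∧ ι Tᶜ = ⊥}`. [this work] -/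
theorem cellCount_of_tableOK (P : Finset (Fin 15 × Fin 15)) (lab : Fin 15 × Fin 15 → ℕ) (hP : tableOK P lab)
    {γ : Type*} [Fintype γ] [DecidableEq γ] (ι : Finset γ → Fin 15)
    (hmono : ∀ A B : Finset γ, A ⊆ B → ple (ι A) (ι B) = true) :
    #(Finset.univ.filter fun T => (ι T, ι Tᶜ) ∈ P) ≤ #(Finset.univ.filter fun T => isAC (ι T) ∧ ι Tᶜ = 0) := by
  classical
  set 𝒯 : Finset (Finset γ) := Finset.univ.filter (fun T => (ι T, ι Tᶜ) ∈ P) with h𝒯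
  set 𝔊 : Finset (Finset γ) := Finset.univ.filter (fun T => isAC (ι T) ∧ ι Tᶜ = 0) with h𝔊
  have hmem : ∀ T, T ∈ 𝒯 ↔ (ι T, ι Tᶜ) ∈ P := by
    intro T; rw [h𝒯, Finset.mem_filter]; simp
  have hGmem : ∀ T, T ∈ 𝔊 ↔ isAC (ι T) ∧ ι Tᶜ = 0 := by
    intro T; rw [h𝔊, Finset.mem_filter]; simp
  -- the labelling of a point
  let θ : Finset γ → ℕ := fun T => lab (ι T, ι Tᶜ)
  have hθ : ∀ s ∈ 𝒯, 1 ≤ θ s ∧ θ s ≤ 9 := fun s hs => (hP _ ((hmem s).1 hs)).1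
  have hpc : ∀ s ∈ 𝒯, ∀ s' ∈ 𝒯, pairOK (ι s, ι sᶜ) (ι s', ι s'ᶜ) (θ s) (θ s') = true :=
    fun s hs s' hs' => (hP _ ((hmem s).1 hs)).2 _ ((hmem s').1 hs')
  -- monotonicity facts used repeatedly
  have hle_union_left : ∀ s t : Finset γ, ple (ι s) (ι (s ∪ t)) = true :=
    fun s t => hmono _ _ Finset.subset_union_left
  have hle_union_right : ∀ s t : Finset γ, ple (ι t) (ι (s ∪ t)) = true :=
    fun s t => hmono _ _ Finset.subset_union_right
  have hle_cunion_left : ∀ s t : Finset γ, ple (ι (s ∪ t)ᶜ) (ι sᶜ) = true :=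
    fun s t => hmono _ _ (Finset.compl_subset_compl.2 Finset.subset_union_left)
  have hle_cunion_right : ∀ s t : Finset γ, ple (ι (s ∪ t)ᶜ) (ι tᶜ) = true :=
    fun s t => hmono _ _ (Finset.compl_subset_compl.2 Finset.subset_union_right)
  -- CONT
  have hcont : ∀ s ∈ 𝒯, ∀ s' ∈ 𝒯, s ⊆ s' → (θ s, θ s') ∈ NineType.contPairs := by
    intro s hs s' hs' hss'
    exact pairOK_cont (hpc s hs s' hs') (hmono _ _ hss') (hmono _ _ (Finset.compl_subset_compl.2 hss'))
  -- COV
  have hcov : ∀ s ∈ 𝒯, ∀ s' ∈ 𝒯, s ≠ s' → s ∪ s' ≠ Finset.univ := by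
    intro s hs s' hs' _ hU
    apply pairOK_cov (hpc s hs s' hs')
    have h1 : sᶜ ⊆ s' := by
      intro e he; rw [Finset.mem_compl] at he
      have : e ∈ s ∪ s' := hU ▸ Finset.mem_univ e
      rcases Finset.mem_union.1 this with h | h
      · exact absurd h he
      · exact h
    have h2 : s'ᶜ ⊆ s := by
      intro e he; rw [Finset.mem_compl] at he
      have : e ∈ s ∪ s' := hU ▸ Finset.mem_univ e
      rcases Finset.mem_union.1 this with h | h
      · exact h
      · exact absurd h he
    exact ⟨hmono _ _ h1, hmono _ _ h2⟩
  -- goods are an up-set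
  have hG : ∀ g ∈ 𝔊, ∀ g' : Finset γ, g ⊆ g' → g' ∈ 𝔊 := by
    intro g hg g' hgg'
    rw [hGmem] at hg ⊢
    refine ⟨ac_up_bot_down.1 _ _ hg.1 (hmono _ _ hgg'), ac_up_bot_down.2 _ ?_⟩
    rw [← hg.2]
    exact hmono _ _ (Finset.compl_subset_compl.2 hgg')
  -- HL-forced goods
  have hHL : ∀ s ∈ 𝒯, ∀ s' ∈ 𝒯, NineType.hlOK (θ s) (θ s') = true → s ∪ s'ᶜ ∈ 𝔊 := by
    intro s hs s' hs' hok
    obtain ⟨hj, hm⟩ := pairOK_hl (hpc s hs s' hs') hok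
    rw [hGmem]
    refine ⟨hj _ (hle_union_left s s'ᶜ) (hle_union_right s s'ᶜ), hm _ (hle_cunion_left s s'ᶜ) ?_⟩
    have h := hle_cunion_right s s'ᶜ
    rw [compl_compl] at h
    exact h
  -- HH-forced goods
  have hHH : ∀ s ∈ 𝒯, ∀ s' ∈ 𝒯, s ≠ s' → NineType.hhOK (θ s) (θ s') = true → s ∪ s' ∈ 𝔊 := by
    intro s hs s' hs' _ hok
    obtain ⟨hj, hm⟩ := pairOK_hh (hpc s hs s' hs') hok
    rw [hGmem]
    exact ⟨hj _ (hle_union_left s s') (hle_union_right s s'), hm _ (hle_cunion_left s s') (hle_cunion_right s s')⟩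
  exact NineType.card_bad_le_card_good 𝒯 θ hθ hcont hcov 𝔊 hG hHL hHH

/-! ## The kernel of a certificate is good -/

/-- **Certificates give good kernels.**  If `tableOK P lab` then `kerP P` is a `GoodKernel`: the antipodal count
`#{T : ι T ∈ AC, ι Tᶜ = ⊥} − #{T : (ι T, ι Tᶜ) ∈ P}` is nonnegative for every monotone equivalence-valued profile map.
[this work] -/
theorem goodKernel_kerP (P : Finset (Fin 15 × Fin 15)) (lab : Fin 15 × Fin 15 → ℕ) (hP : tableOK P lab) :
    GoodKernel (kerP P) := by
  classical
  refine ⟨fun γ _ _ Q hmono heqv => ?_⟩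
  have hex : ∀ T : Finset γ, ∃ i : Fin 15, Q T = pp i := fun T => exists_pat_of_isEqv (heqv T)
  choose ι hι using hex
  have hle : ∀ A B : Finset γ, A ⊆ B → ple (ι A) (ι B) = true := by
    intro A B hAB
    apply ple_of_profLE
    rw [← hι A, ← hι B]
    exact hmono A B hAB
  have hcount := cellCount_of_tableOK P lab hP ι hle
  have hsum : (∑ T : Finset γ, liftK (kerP P) (Q T) (Q Tᶜ)) =
      (#(Finset.univ.filter fun T => isAC (ι T) ∧ ι Tᶜ = 0) : ℤ) -
        (#(Finset.univ.filter fun T => (ι T, ι Tᶜ) ∈ P) : ℤ) := by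
    have h1 : ∀ T : Finset γ, liftK (kerP P) (Q T) (Q Tᶜ) =
        (if isAC (ι T) ∧ ι Tᶜ = 0 then (1 : ℤ) else 0) - (if (ι T, ι Tᶜ) ∈ P then (1 : ℤ) else 0) := by
      intro T; rw [hι T, hι Tᶜ, liftK_pp]; rfl
    simp_rw [h1]
    rw [Finset.sum_sub_distrib, Finset.sum_boole, Finset.sum_boole]
  have : (#(Finset.univ.filter fun T => (ι T, ι Tᶜ) ∈ P) : ℤ) ≤
      (#(Finset.univ.filter fun T => isAC (ι T) ∧ ι Tᶜ = 0) : ℤ) := by exact_mod_cast hcount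
  rw [hsum]; linarith

/-! ## Law level -/

/-- Evaluation of the certificate kernel form: `Σ_{i,j} kerP P i j·cᵢ·cⱼ = (c₁₁ + c₁₄)·c₀ − Σ_{p ∈ P} c_{p.1}·c_{p.2}`.
[this work] -/
theorem sum_kerP_cell (P : Finset (Fin 15 × Fin 15)) (c : Fin 15 → ℝ) :
    (∑ i : Fin 15, ∑ j : Fin 15, (kerP P i j : ℝ) * c i * c j) =
      (c 11 + c 14) * c 0 - ∑ p ∈ P, c p.1 * c p.2 := by
  classical
  have hsplit : ∀ i j : Fin 15, (kerP P i j : ℝ) * c i * c j =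
      (if isAC i ∧ j = 0 then c i * c j else 0) - (if (i, j) ∈ P then c i * c j else 0) := by
    intro i j; unfold kerP; push_cast; split_ifs <;> ring
  simp_rw [hsplit, Finset.sum_sub_distrib]
  congr 1
  · have h0 : ∀ i : Fin 15, (∑ j : Fin 15, if isAC i ∧ j = 0 then c i * c j else 0) =
        if isAC i then c i * c 0 else 0 := by
      intro i
      by_cases hi : isAC i
      · rw [if_pos hi, Finset.sum_eq_single (0 : Fin 15)]
        · rw [if_pos ⟨hi, rfl⟩]
        · intro j _ hj; rw [if_neg]; rintro ⟨_, h⟩; exact hj h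
        · intro h; exact absurd (Finset.mem_univ _) h
      · rw [if_neg hi]; exact Finset.sum_eq_zero fun j _ => by rw [if_neg]; rintro ⟨h, _⟩; exact hi h
    simp_rw [h0]
    rw [Finset.sum_ite, Finset.sum_const_zero, add_zero]
    have hf : (Finset.univ.filter fun i : Fin 15 => isAC i) = {11, 14} := by decide
    rw [hf, Finset.sum_pair (by decide)]; ring
  · rw [← Finset.sum_product' (f := fun i j => if (i, j) ∈ P then c i * c j else 0)]
    rw [← Finset.sum_filter]
    have hPs : (Finset.univ ×ˢ (Finset.univ : Finset (Fin 15))).filter (fun p : Fin 15 × Fin 15 => (p.1, p.2) ∈ P) = P := by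
      ext p
      simp only [Finset.mem_filter, Finset.mem_product, Finset.mem_univ, true_and, Prod.mk.eta]
    rw [hPs]

/-- **Packing inequality of a certificate, all `n`.**  If `tableOK P lab` then for every finite weighted graph and all marked
points `a b c y`: `Σ_{(h,l) ∈ P} cell h · cell l ≤ (cell(ab|cy) + cell(abcy)) · cell(a|b|c|y)`. [this work] -/
theorem pack_of_tableOK (P : Finset (Fin 15 × Fin 15)) (lab : Fin 15 × Fin 15 → ℕ) (hP : tableOK P lab)
    {n : ℕ} (w : Sym2 (Fin n) → unitInterval) (a b c y : Fin n) :
    ∑ p ∈ P, cell w a b c y p.1 * cell w a b c y p.2 ≤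
      (cell w a b c y 11 + cell w a b c y 14) * cell w a b c y 0 := by
  have h := sum_kernel_cell_nonneg (goodKernel_kerP P lab hP) w a b c y
  rw [sum_kerP_cell P] at h
  linarith

/-- Sanity witness: `Q44b`'s nine (heavy, light) pairs with their own labels pass the table check. [this work] -/
theorem tableOK_q44b :
    tableOK ({(11, 9), (11, 8), (6, 9), (6, 8), (6, 1), (6, 10), (6, 7), (7, 5), (7, 4)} : Finset (Fin 15 × Fin 15))
      (fun p => if p = (11, 9) then 1 else if p = (11, 8) then 2 else if p = (6, 9) then 3 else if p = (6, 8) then 4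
        else if p = (6, 1) then 5 else if p = (6, 10) then 6 else if p = (6, 7) then 7 else if p = (7, 5) then 8 else 9) := by
  decide +kernel

end TwoCopyMono

end Summit.CriticalPhenomena.PercolationContinuityZ3.Theorems
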